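import Literature.Computability.Complexity.ExpPadding
import Literature.Computability.Complexity.MapFstMachine
import Literature.Computability.Complexity.StringCopy
import Literature.Computability.Complexity.StackBricksStrings
import Literature.Computability.Complexity.GrowthBounds
import HarnessLib

/-!
# `2^{O(n)}`-time string maps: closure under `FP`, `⟨x, y⟩ ↦ ⟨g x, y⟩`, preimages of `P` languages are in `E`

Bookkeeping for exponential-time arguments over the tree's machine model
(Mathlib's `Turing.FinTM2`, `TimeComputable`/`TimeDecidable` of `TimeBounds.lean`, classes `E`,
`EXP` of `Classes.lean`), assembled from machines the tree already has — nothing is programmed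
here:

* bridges between the tree's `IsExpBounded` (`GrowthBounds.lean`: `f n ≤ 2^{cn + c}`, with its
  closure API `add/mul/pow/of_isPBounded/isPBounded_comp`) and the arithmetic shape `K · 2^{c n} + K`
  of the time classes (`IsExpBounded.exists_le_mul_add`, `of_le_mul_add`, `shape`), plus `poly`,
  `poly_comp`, `comp_linear`, `le_two_pow_sq` (`2^{O(n)} ≤ K · 2^{n²} + K`);
* `FE = ⋃_c FTIME(2^{cn})`, the string maps computable in time `2^{O(n)}` (the function-class
  analogue of `E = ⋃_c DTIME(2^{cn})`, `Classes.lean`; Arora–Barak 2009, §2.6.2; unfolded by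
  `mem_FE_iff`): `FP ⊆ FE` (`mem_FE_of_mem_FP`), the exponential
  pad `expPad 1 ∈ FE` (`ExpPadding.lean`), `g ∘ f ∈ FE` for `f ∈ FP` with linearly bounded output and
  `g ∈ FE` (`comp_mem_FE_of_linear`), `f ∘ g ∈ FE` for `g ∈ FE`, `f ∈ FP` (`comp_mem_FE`) — both by
  the sequential composition `TimeComputable.comp_holds` (`TimeBoundsProofs.lean`) and the push
  bound `TM2Comp.length_le_of_outputsWithin` on output lengths;
* `mapFstFn_mem_FE` : `⟨x, y⟩ ↦ ⟨g x, y⟩ ∈ FE` for `g ∈ FE` — the machine `mapFstAux` of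
  `MapFstMachine.lean`, whose running-time lemma `outputsWithin_mapFstAux` is stated for an
  arbitrary step count;
* `preimage_mem_E`, `preimage_mem_EXP` : `g⁻¹(A) ∈ E ⊆ EXP` for `g ∈ FE`, `A ∈ P`; `E_subset_EXP`;
* the linear-exponential pad `lpad a x = ⟨1^{2^{a|x|}} 0 1^{a|x|}, x⟩` (`= mapFstFn (expPad 1 ∘
  onesMulFn a) ∘ copyFn`, `lpad_eq`): `lpad a ∈ FE` (`lpad_mem_FE`), `2^{a|x|} ≤ |lpad a x| ≤ 8 · 2^{a|x|}`,
  payload recovered by the pair projection (`boolUnpair_lpad_snd`).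

First client: the discharge programme of `Literature.Barriers.PneNP.MCSPKarpHardness`
(Murray–Williams 2017, Thm. 1.6; `Barriers/PneNP/MCSPHardnessObstructionsProofs.lean`), where the
languages `BITS_R = {⟨x, u⟩ | bit u of R(pad x)}` and `{⟨x, y⟩ | ⟨R(pad x), y⟩ ∈ Ver}` are placed in
`EXP` by `preimage_mem_EXP ∘ mapFstFn_mem_FE`.

## References

* S. Arora, B. Barak, *Computational Complexity: A Modern Approach*, CUP 2009, §1.3 (Claim 1.6:
  machines as subroutines, running times compose), §2.6.2 (`E`, `EXP`), Thm. 2.8 (proof).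
* C. D. Murray, R. R. Williams, *On the (non) NP-hardness of computing circuit complexity*,
  Theory of Computing 13 (2017), proof of Thm. 4.1 (the padded reduction `R`, `BITS_R ∈ EXP`).
-/

namespace Literature.Computability.Complexity

open _root_.Computability Turing Polynomial

/-! ### Exponentially bounded functions: bridges to the shape `K · 2^{c n} + K` -/

namespace IsExpBounded

/-- An exponentially bounded function in the arithmetic shape `K · 2^{c n} + K` of the tree's
time classes (`K = 2^c`). [folklore] -/
theorem exists_le_mul_add {f : ℕ → ℕ} (hf : IsExpBounded f) :
    ∃ c K : ℕ, ∀ n, f n ≤ K * 2 ^ (c * n) + K := by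
  obtain ⟨c, hc⟩ := hf
  refine ⟨c, 2 ^ c, fun n => (hc n).trans ?_⟩
  rw [pow_add, mul_comm]
  exact Nat.le_add_right _ _

/-- Conversely the shape `K · 2^{c n} + K` is exponentially bounded. [folklore] -/
theorem of_le_mul_add {f : ℕ → ℕ} {c K : ℕ} (h : ∀ n, f n ≤ K * 2 ^ (c * n) + K) :
    IsExpBounded f := by
  refine ⟨c + K + 1, fun n => (h n).trans ?_⟩
  have hK : K ≤ 2 ^ K := (Nat.lt_two_pow_self).le
  calc K * 2 ^ (c * n) + K ≤ K * 2 ^ (c * n) + K * 2 ^ (c * n) :=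
        Nat.add_le_add_left (Nat.le_mul_of_pos_right _ (Nat.two_pow_pos _)) _
    _ = 2 ^ (c * n) * K * 2 := by ring
    _ ≤ 2 ^ (c * n) * 2 ^ K * 2 := by gcongr
    _ = 2 ^ (c * n + K + 1) := by rw [pow_succ, pow_add]
    _ ≤ 2 ^ ((c + K + 1) * n + (c + K + 1)) := Nat.pow_le_pow_right Nat.two_pos (by nlinarith)

/-- The shape itself. [folklore] -/
theorem shape (c K : ℕ) : IsExpBounded fun n => K * 2 ^ (c * n) + K := of_le_mul_add fun _ => le_rfl

/-- Polynomials are exponentially bounded. [folklore] -/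
theorem poly (p : Polynomial ℕ) : IsExpBounded fun n => p.eval n :=
  of_isPBounded ((AlgebraicComplexity.isPBounded_iff_exists_polynomial_holds _).2 ⟨p, fun _ => le_rfl⟩)

/-- The identity is exponentially bounded. [folklore] -/
theorem id : IsExpBounded fun n => n := (poly X).mono fun n => by simp

/-- Constant multiples. [folklore] -/
theorem const_mul {f : ℕ → ℕ} (hf : IsExpBounded f) (a : ℕ) : IsExpBounded fun n => a * f n :=
  (const a).mul hf

/-- Post-composition with a polynomial (`poly(2^{O(n)}) = 2^{O(n)}`, `isPBounded_comp`). [folklore] -/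
theorem poly_comp {f : ℕ → ℕ} (p : Polynomial ℕ) (hf : IsExpBounded f) :
    IsExpBounded fun n => p.eval (f n) :=
  isPBounded_comp ((AlgebraicComplexity.isPBounded_iff_exists_polynomial_holds _).2 ⟨p, fun _ => le_rfl⟩) hf

/-- Pre-composition of a monotone exponentially bounded function with a linearly bounded one.
[folklore] -/
theorem comp_linear {f : ℕ → ℕ} (hf : IsExpBounded f) (hmono : Monotone f) (a : ℕ) {s : ℕ → ℕ}
    (hs : ∀ n, s n ≤ a * n + a) : IsExpBounded fun n => f (s n) := by
  obtain ⟨c, hc⟩ := hf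
  refine ⟨c * a + c, fun n => ?_⟩
  calc f (s n) ≤ f (a * n + a) := hmono (hs n)
    _ ≤ 2 ^ (c * (a * n + a) + c) := hc _
    _ ≤ 2 ^ ((c * a + c) * n + (c * a + c)) := Nat.pow_le_pow_right Nat.two_pos (by nlinarith)

/-- An exponentially bounded function is below `K · 2^{n²} + K` (so `DTIME` of it lies in `EXP`).
[folklore] -/
theorem le_two_pow_sq {f : ℕ → ℕ} (hf : IsExpBounded f) : ∃ K, ∀ n, f n ≤ K * 2 ^ (n ^ 2) + K := by
  obtain ⟨c, hc⟩ := hf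
  refine ⟨2 ^ (c * c + c), fun n => (hc n).trans ?_⟩
  have key : c * n ≤ c * c + n ^ 2 := by
    rcases le_or_gt c n with h | h <;> nlinarith
  calc 2 ^ (c * n + c) ≤ 2 ^ (c * c + c + n ^ 2) := Nat.pow_le_pow_right Nat.two_pos (by omega)
    _ = 2 ^ (c * c + c) * 2 ^ (n ^ 2) := by rw [pow_add]
    _ ≤ _ := Nat.le_add_right _ _

end IsExpBounded

/-! ### `2^{O(n)}`-time string maps -/

/-- `FE`: the string functions computable (by a TM2 machine, encoders `id`) within a
linear-exponential number of steps `K · 2^{c n} + K` — the function-class analogue of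
`E = ⋃_c DTIME(2^{c n})` (`Classes.lean`; Arora–Barak 2009, §2.6.2). [cite: AroraBarakCC2009, §2.6.2] -/
def FE : Set (List Bool → List Bool) :=
  ⋃ c : ℕ, FTIME fun n => 2 ^ (c * n)

/-- Membership in `FE`, unfolded (`FTIME t` is `{f | ∃ K, TimeComputable id id f (K · t + K)}`).
[cite: AroraBarakCC2009, §2.6.2] -/
theorem mem_FE_iff {g : List Bool → List Bool} :
    g ∈ FE ↔ ∃ c K : ℕ, TimeComputable (id : List Bool → List Bool) id g fun n => K * 2 ^ (c * n) + K := by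
  simp [FE, FTIME]

/-- A map computable within an exponentially bounded time is in `FE`. [folklore] -/
theorem mem_FE_of_isExpBounded {g : List Bool → List Bool} {t : ℕ → ℕ}
    (hg : TimeComputable (id : List Bool → List Bool) id g t) (ht : IsExpBounded t) : g ∈ FE := by
  obtain ⟨c, K, hK⟩ := ht.exists_le_mul_add
  exact mem_FE_iff.2 ⟨c, K, hg.mono hK⟩

/-- `FP ⊆ FE`. [cite: AroraBarakCC2009, §2.6.2] -/
theorem mem_FE_of_mem_FP {f : List Bool → List Bool} (hf : f ∈ FP) : f ∈ FE := by
  obtain ⟨p, hp⟩ := hf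
  exact mem_FE_of_isExpBounded hp (IsExpBounded.poly p)

/-- The exponential pad `expPad 1 : x ↦ 1^{2^{|x|}} 0 x` is in `FE` (`ExpPadding.lean`). [folklore] -/
theorem expPad_one_mem_FE : expPad 1 ∈ FE := by
  obtain ⟨C, hC⟩ := exists_timeComputable_expPad (k := 1) le_rfl
  exact mem_FE_of_isExpBounded hC ((IsExpBounded.shape 1 C).mono fun n => by simp)

/-- The time bound `K 2^{cn} + K` is monotone. [folklore] -/
theorem monotone_expLin (c K : ℕ) : Monotone fun n : ℕ => K * 2 ^ (c * n) + K := by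
  intro a b hab
  dsimp only
  gcongr
  · norm_num

/-- **`FE` after `FP` with linearly bounded output**: if `f ∈ FP` has `|f w| ≤ a |w| + a` and
`g ∈ FE` then `g ∘ f ∈ FE` (sequential composition, `TimeComputable.comp_holds`).
[cite: AroraBarakCC2009, §1.3 (Claim 1.6)] -/
theorem comp_mem_FE_of_linear {f g : List Bool → List Bool} (hg : g ∈ FE) (hf : f ∈ FP) (a : ℕ)
    (hlen : ∀ w, (f w).length ≤ a * w.length + a) : g ∘ f ∈ FE := by
  obtain ⟨c, K, hK⟩ := mem_FE_iff.1 hg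
  obtain ⟨p, hp⟩ := hf
  obtain ⟨C, hC⟩ := TimeComputable.comp_holds hK hp (monotone_expLin c K) (s := fun n => a * n + a)
    (fun w => hlen w)
  refine mem_FE_of_isExpBounded hC ?_
  have h1 : IsExpBounded fun n => K * 2 ^ (c * (a * n + a)) + K :=
    (IsExpBounded.shape c K).comp_linear (monotone_expLin c K) a (s := fun n => a * n + a) fun _ => le_rfl
  have h2 : IsExpBounded fun n => a * n + a :=
    (IsExpBounded.id.const_mul a).add (IsExpBounded.const a)
  have h3 := ((((IsExpBounded.poly p).add h1).add h2).const_mul C).add (IsExpBounded.const C)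
  exact h3.mono fun n => le_rfl

/-- The encoded outputs of an `FE` map have linear-exponential length (a machine pushes boundedly
many symbols per step, `TM2Comp.length_le_of_outputsWithin`). [folklore] -/
theorem exists_length_le_of_mem_FE {g : List Bool → List Bool} (hg : g ∈ FE) :
    ∃ s : ℕ → ℕ, IsExpBounded s ∧ Monotone s ∧ ∀ w, (g w).length ≤ s w.length := by
  obtain ⟨c, K, M, hM⟩ := mem_FE_iff.1 hg
  refine ⟨fun n => n + TM2Comp.machinePushBound M.tm * (K * 2 ^ (c * n) + K),
    IsExpBounded.id.add ((IsExpBounded.shape c K).const_mul _), ?_, fun w => ?_⟩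
  · intro a b hab
    dsimp only
    have := monotone_expLin c K hab
    gcongr
  · simpa using TM2Comp.length_le_of_outputsWithin M (hM w)

/-- **`FP` after `FE`**: if `g ∈ FE` and `f ∈ FP` then `f ∘ g ∈ FE` (the intermediate word has
length `2^{O(n)}`, and a polynomial of that is `2^{O(n)}`). [cite: AroraBarakCC2009, §1.3 (Claim 1.6)] -/
theorem comp_mem_FE {f g : List Bool → List Bool} (hf : f ∈ FP) (hg : g ∈ FE) : f ∘ g ∈ FE := by
  obtain ⟨s, hs, hsm, hsl⟩ := exists_length_le_of_mem_FE hg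
  obtain ⟨c, K, hK⟩ := mem_FE_iff.1 hg
  obtain ⟨p, hp⟩ := hf
  obtain ⟨C, hC⟩ := TimeComputable.comp_holds hp hK (fun a b h => TM2Iter.eval_mono p h) (s := s) hsl
  refine mem_FE_of_isExpBounded hC ?_
  have h3 := ((((IsExpBounded.shape c K).add (hs.poly_comp p)).add hs).const_mul C).add
    (IsExpBounded.const C)
  exact h3.mono fun n => le_rfl

/-- **`⟨x, y⟩ ↦ ⟨g x, y⟩` at exponential scale**: for `g ∈ FE`, `mapFstFn g ∈ FE` — the machine
`mapFstAux` of `MapFstMachine.lean` with its general running-time lemma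
`outputsWithin_mapFstAux` (`m + 3 |out| + 2 |z| + 6`). [cite: AroraBarakCC2009, Thm. 2.8 (proof) and §1.3] -/
theorem mapFstFn_mem_FE {g : List Bool → List Bool} (hg : g ∈ FE) : mapFstFn g ∈ FE := by
  obtain ⟨c, K, M, hM⟩ := mem_FE_iff.1 hg
  set D := TM2Comp.machinePushBound M.tm
  refine mem_FE_of_isExpBounded (t := fun n => (K * 2 ^ (c * n) + K) +
      3 * (n + D * (K * 2 ^ (c * n) + K)) + 2 * n + 6) ⟨mapFstAux M, fun z => ?_⟩ ?_
  · have hx := length_boolUnpair_fst_le z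
    have hz : M.OutputsWithin (boolUnpair z).1 (g (boolUnpair z).1) (K * 2 ^ (c * z.length) + K) :=
      (hM (boolUnpair z).1).mono (monotone_expLin c K hx)
    have hlen := TM2Comp.length_le_of_outputsWithin M hz
    refine (outputsWithin_mapFstAux M hz).mono ?_
    simp only [id]
    have : (g (boolUnpair z).1).length ≤ z.length + D * (K * 2 ^ (c * z.length) + K) := by
      simpa using hlen.trans (Nat.add_le_add_right hx _)
    omega
  · have h3 := ((((IsExpBounded.shape c K).add ((IsExpBounded.id.add ((IsExpBounded.shape c K).const_mul
      D)).const_mul 3)).add (IsExpBounded.id.const_mul 2)).add (IsExpBounded.const 6))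
    exact h3.mono fun n => le_rfl

/-! ### Preimages of `P` languages under `FE` maps -/

/-- **`g⁻¹(A) ∈ E` for `g ∈ FE`, `A ∈ P`**: run `g`, then the polynomial-time decider of `A` on a
word of length `2^{O(n)}`. [cite: AroraBarakCC2009, §2.6.2 and §1.3 (Claim 1.6)] -/
theorem preimage_mem_E {g : List Bool → List Bool} (hg : g ∈ FE) {A : Language Bool}
    (hA : A ∈ Classes.P) : (g ⁻¹' A : Language Bool) ∈ E := by
  obtain ⟨s, hs, hsm, hsl⟩ := exists_length_le_of_mem_FE hg
  obtain ⟨c, K, hK⟩ := mem_FE_iff.1 hg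
  simp only [Classes.P, Set.mem_iUnion] at hA
  obtain ⟨k, a, hdec⟩ := hA
  have hmono : Monotone fun n : ℕ => a * n ^ k + a := fun x y h => by dsimp only; gcongr
  have hdec' : TimeComputable (id : List Bool → List Bool) encodeBool A.boolIndicator
      fun n => a * n ^ k + a := hdec
  obtain ⟨C, hC⟩ := TimeComputable.comp_holds hdec' hK hmono (s := s) hsl
  have hind : A.boolIndicator ∘ g = (g ⁻¹' A).boolIndicator := by
    funext w
    rfl
  rw [hind] at hC
  have h1 : IsExpBounded fun n => a * s n ^ k + a := ((hs.pow k).const_mul a).add (IsExpBounded.const a)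
  have h3 := (((((IsExpBounded.shape c K).add h1).add hs).const_mul C).add (IsExpBounded.const C))
  obtain ⟨c', K', hK'⟩ : ∃ c' K' : ℕ, ∀ n,
      C * (K * 2 ^ (c * n) + K + (a * s n ^ k + a) + s n) + C ≤ K' * 2 ^ (c' * n) + K' :=
    (h3.mono fun n => le_rfl).exists_le_mul_add
  have hfin : (g ⁻¹' A : Language Bool) ∈ TimeClass fun n => K' * 2 ^ (c' * n) + K' :=
    hC.mono hK'
  exact Set.mem_iUnion.2 ⟨c', K', hfin⟩

/-- `E ⊆ EXP` (`2^{cn} ≤ 2^{c²} · 2^{n²}`). [cite: AroraBarakCC2009, §2.6.2] -/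
theorem E_subset_EXP : E ⊆ EXP := by
  intro L hL
  rw [E, Set.mem_iUnion] at hL
  obtain ⟨c, K, hK⟩ := hL
  obtain ⟨K', hK'⟩ := (IsExpBounded.shape c K).le_two_pow_sq
  rw [EXP, Set.mem_iUnion]
  exact ⟨2, K', timeClass_mono hK' hK⟩

/-- Hence `g⁻¹(A) ∈ EXP` for `g ∈ FE`, `A ∈ P`. [cite: AroraBarakCC2009, §2.6.2] -/
theorem preimage_mem_EXP {g : List Bool → List Bool} (hg : g ∈ FE) {A : Language Bool}
    (hA : A ∈ Classes.P) : (g ⁻¹' A : Language Bool) ∈ EXP :=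
  E_subset_EXP (preimage_mem_E hg hA)

/-! ### The linear-exponential pad `x ↦ ⟨1^{2^{a|x|}} 0 1^{a|x|}, x⟩` -/

/-- The pad `lpad a x = ⟨expPad 1 (1^{a |x|}), x⟩ = ⟨1^{2^{a|x|}} 0 1^{a|x|}, x⟩`: of length at least
`2^{a |x|}`, carrying `x` verbatim as second component (so that `x` is recovered by the pair
projection, and a decider that may spend time exponential in `|x|`-many doublings is polynomial
in the padded length). Cf. Murray–Williams' `x 0 1^{2^{|x|^c}}`. [cite: MurrayWilliams2017, Thm. 4.1 (proof)] -/
def lpad (a : ℕ) (x : List Bool) : List Bool :=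
  boolPair (expPad 1 (List.replicate (a * x.length) true)) x

/-- Length of the pad. [folklore] -/
theorem length_lpad (a : ℕ) (x : List Bool) :
    (lpad a x).length = 2 * (2 ^ (a * x.length) + a * x.length + 1) + 2 + x.length := by
  simp [lpad, length_expPad]

/-- `2^{a|x|} ≤ |lpad a x|`. [folklore] -/
theorem two_pow_le_length_lpad (a : ℕ) (x : List Bool) : 2 ^ (a * x.length) ≤ (lpad a x).length := by
  rw [length_lpad]; omega

/-- `|lpad a x| ≤ 8 · 2^{a|x|}` for `1 ≤ a`, hence linear-exponential. [folklore] -/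
theorem length_lpad_le {a : ℕ} (ha : 1 ≤ a) (x : List Bool) :
    (lpad a x).length ≤ 8 * 2 ^ (a * x.length) := by
  rw [length_lpad]
  have h1 : a * x.length + 1 ≤ 2 ^ (a * x.length) := Nat.lt_two_pow_self
  have h2 : x.length < 2 ^ x.length := Nat.lt_two_pow_self
  have h3 : 2 ^ x.length ≤ 2 ^ (a * x.length) :=
    Nat.pow_le_pow_right Nat.two_pos (Nat.le_mul_of_pos_left _ ha)
  omega

/-- The second component of the pad is the payload. [folklore] -/
@[simp] theorem boolUnpair_lpad_snd (a : ℕ) (x : List Bool) : (boolUnpair (lpad a x)).2 = x := by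
  simp [lpad]

/-- The pad as a composite of library maps: copy, then `expPad 1 ∘ onesMulFn a` on the first copy.
[folklore] -/
theorem lpad_eq (a : ℕ) : lpad a = mapFstFn (expPad 1 ∘ Brick.onesMulFn a) ∘ copyFn := by
  funext x
  simp [lpad, Function.comp, copyFn_apply, mapFstFn_boolPair, Brick.onesMulFn]

/-- **The pad is computable in time `2^{O(n)}`**: `lpad a ∈ FE`. [folklore] -/
theorem lpad_mem_FE (a : ℕ) : lpad a ∈ FE := by
  rw [lpad_eq]
  refine comp_mem_FE_of_linear (mapFstFn_mem_FE ?_) copyFn_mem_FP 3 fun w => ?_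
  · exact comp_mem_FE_of_linear expPad_one_mem_FE (Brick.onesMulFn_mem_FP a) a fun w => by
      simp [Brick.onesMulFn]
  · rw [copyFn_apply, length_boolPair]; omega

end Literature.Computability.Complexity
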